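import Summits.CriticalPhenomena.Ising3DConformalLimit.Theorems.EnergyNotSigmaSquaredEnergyGapSoftRatioRegular

/-!
# The quantitative ray lemma for an abstract positive lattice function on `ℤ³`
(item stmt-CriticalPhenomena-4469, crux `EnergyGapPowerLaw`, route `EnergyNotSigmaSquared`;
the registered stub `stub_rayRatioPowerBound` of the birth skeleton
`Cruxes/EnergyGapPowerLaw/Lines/birth.lean`, line `registered`)

Let `F > 0` on `ℤ³` and `e` a unit lattice vector (sup norm).  Assume

* growth along rays (the statement of the neighbouring stub `stub_rayGrowth` for `F, e`, taken as a
  hypothesis): if `a ≤ (1 - Lη)·F(x+e)/F(x)` and `(1-η)F(y)² ≤ F(y+e)F(y-e)` at the interior points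
  `y = x + (j+1)e`, `j + 2 ≤ L`, then `a^L F(x) ≤ F(x + Le)`;
* the polynomial ray ceiling `F(x + Ke) ≤ c⁻¹K²F(x)` (`K ≥ 1`);
* power-rate asymptotic log-convexity `(1 - C‖y‖^{-κ})F(y)² ≤ F(y+e)F(y-e)` for `y ≠ 0`
  (`0 < κ ≤ 1`, `0 ≤ C`).

Then `F(x+e)/F(x) ≤ 1 + C'‖x‖^{-κ'}` for `‖x‖ ≥ R`, with `κ' = κ/5`, `C' = 2^{κ/5}`
(`stub_rayRatioPowerBound`).  This is the quantitative upgrade of the soft ray argument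
`ratio_le_of_lowerSecondRatio_of_ceiling` (`…EnergyGapSoftRatioRegular`).

Proof.  Write `s = ‖x‖/2`, `t = s^{κ/5} ≥ 1`, `v = t⁻¹ = 2^{κ/5}‖x‖^{-κ/5}`.  If the ratio at `x`
exceeded `1 + v`, run the growth hypothesis with `K = ⌊72t³/c⌋ + 1` (so `K > 72t³/c`), `L = 3K`,
`η = C s^{-κ} = C v⁵`, `a = 1 + v/2`: the thresholds `s^{2/5} ≥ 216/c + 3 =: A` and
`t ≥ 4AC + 1` give `L ≤ A t³ ≤ s` (so every point `x + me`, `m ≤ L`, has norm `≥ s`, where the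
convexity defect is `≤ η`) and `Lη ≤ ACv² ≤ v/4` (so `a ≤ (1 - Lη)(1 + v)`).  Growth and the ceiling
give `a^{3K} ≤ 9K²/c`, while Bernoulli cubed gives `a^{3K} ≥ (1 + Kv/2)³ ≥ K³v³/8`; hence
`K ≤ 72t³/c`, a contradiction.

Nothing here asserts the item; everything is proved, no definitions.

## References

* M. Aizenman, H. Duminil-Copin, Ann. of Math. 194 (2021), Remark 5.10, §5.6
  [AizenmanDuminilCopinAnnals2021].
-/

noncomputable section

namespace Summit.CriticalPhenomena.Ising3DConformalLimit.EnergyNotSigmaSquaredEnergyGapPowerLaw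

open Literature.Probability.LatticeModels
open Summit.CriticalPhenomena.Ising3DConformalLimit.EnergyNotSigmaSquaredEnergyGapSoft
  (norm_sub_le_norm_add_nsmul norm_nsmul_unit)

/-! ### Two scalar lemmas -/

/-- Bernoulli cubed: `(K u)³ ≤ (1 + u)^{3K}` for `u ≥ 0`, from `1 + Ku ≤ (1+u)^K`. [folklore] -/
theorem cube_bernoulli {u : ℝ} (hu : 0 ≤ u) (K : ℕ) : ((K : ℝ) * u) ^ 3 ≤ (1 + u) ^ (3 * K) := by
  have hb : 1 + (K : ℝ) * u ≤ (1 + u) ^ K := one_add_mul_le_pow (by linarith) K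
  have h0 : 0 ≤ (K : ℝ) * u := by positivity
  calc ((K : ℝ) * u) ^ 3 ≤ ((1 + u) ^ K) ^ 3 := pow_le_pow_left₀ h0 (by linarith) 3
    _ = (1 + u) ^ (3 * K) := by rw [← pow_mul, mul_comm]

/-- The scalar contradiction of the ray argument: `K > 72t³/c` is incompatible with
`(K t⁻¹/2)³ ≤ (3K)²/c` (the latter says `K ≤ 72t³/c`). [folklore] -/
theorem scalar_contra {c t K : ℝ} (hc : 0 < c) (ht : 0 < t) (hK : 0 < K)
    (hKbig : 72 * t ^ 3 / c < K) (h : (K * (t⁻¹ / 2)) ^ 3 ≤ (3 * K) ^ 2 / c) : False := by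
  have htv : t * t⁻¹ = 1 := mul_inv_cancel₀ ht.ne'
  rw [div_lt_iff₀ hc] at hKbig
  rw [le_div_iff₀ hc] at h
  have hpos : 0 < K ^ 2 * t⁻¹ ^ 3 / 8 := by positivity
  have h1 := mul_lt_mul_of_pos_right hKbig hpos
  have e1 : 72 * t ^ 3 * (K ^ 2 * t⁻¹ ^ 3 / 8) = 9 * K ^ 2 * (t * t⁻¹) ^ 3 := by ring
  have e2 : K * c * (K ^ 2 * t⁻¹ ^ 3 / 8) = (K * (t⁻¹ / 2)) ^ 3 * c := by ring
  have e3 : (3 * K) ^ 2 = 9 * K ^ 2 := by ring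
  rw [e1, e2, htv] at h1
  rw [e3] at h
  linarith

/-! ### The stub -/

/-- **The quantitative ray lemma (stub `stub_rayRatioPowerBound` of the birth skeleton of crux
`EnergyGapPowerLaw`).**  Let `F > 0` on `ℤ³` and `e` a unit lattice vector.  Assume growth along
rays (the neighbouring stub `stub_rayGrowth` for `F, e`, as a hypothesis), the polynomial ray
ceiling `F(x + Ke) ≤ c⁻¹K²F(x)` (`K ≥ 1`), and power-rate asymptotic log-convexity
`(1 - C‖y‖^{-κ})F(y)² ≤ F(y+e)F(y-e)` for `y ≠ 0` (`0 < κ ≤ 1`, `0 ≤ C`).  Then for some `κ' > 0`,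
`C'`, `R`: `F(x+e)/F(x) ≤ 1 + C'‖x‖^{-κ'}` whenever `‖x‖ ≥ R` (here `κ' = κ/5`, `C' = 2^{κ/5}`).
If the ratio at `x` exceeded `1 + v`, `v = (‖x‖/2)^{-κ/5}`, growth over `L = 3K` steps,
`K = ⌊72v⁻³/c⌋ + 1`, with defect `η = C(‖x‖/2)^{-κ}` and rate `a = 1 + v/2` would give
`a^{3K} ≤ 9K²/c` against Bernoulli cubed `a^{3K} ≥ K³v³/8`.
[cite: AizenmanDuminilCopinAnnals2021, Remark 5.10] -/
theorem stub_rayRatioPowerBound :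
    ∀ (F : Site 3 → ℝ) (e : Site 3), ‖e‖ = 1 → (∀ v, 0 < F v) →
      (∀ (x : Site 3) (L : ℕ) (a η : ℝ), 0 ≤ η → η ≤ 1 → 0 ≤ a →
          a ≤ (1 - (L : ℝ) * η) * (F (x + e) / F x) →
          (∀ j : ℕ, j + 2 ≤ L →
            (1 - η) * F (x + (j + 1) • e) ^ 2 ≤ F (x + (j + 1) • e + e) * F (x + (j + 1) • e - e)) →
          a ^ L * F x ≤ F (x + L • e)) →
      ∀ c : ℝ, 0 < c → (∀ K : ℕ, 1 ≤ K → ∀ x : Site 3, F (x + K • e) ≤ (K : ℝ) ^ 2 / c * F x) →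
        ∀ κ C : ℝ, 0 < κ → κ ≤ 1 → 0 ≤ C →
          (∀ y : Site 3, y ≠ 0 → (1 - C * (‖y‖ : ℝ) ^ (-κ)) * F y ^ 2 ≤ F (y + e) * F (y - e)) →
          ∃ κ' C' R : ℝ, 0 < κ' ∧ ∀ x : Site 3, R ≤ ‖x‖ →
            F (x + e) / F x ≤ 1 + C' * (‖x‖ : ℝ) ^ (-κ') := by
  intro F e he hF hgrowth c hc hceil κ C hκ hκ1 hC hconv
  -- the constants `A = 216/c + 3`, `B = 4AC + 1` and the threshold radius `2·max(1, A^{5/2}, B^{5/κ})`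
  set A : ℝ := 216 / c + 3 with hA
  set B : ℝ := 4 * A * C + 1 with hB
  have hApos : 0 < A := by positivity
  have hAC : 0 ≤ 4 * A * C := by positivity
  have hBpos : 0 < B := by linarith
  have hκ5 : 0 < κ / 5 := by positivity
  refine ⟨κ / 5, (2 : ℝ) ^ (κ / 5), 2 * max 1 (max (A ^ ((2 : ℝ) / 5)⁻¹) (B ^ (κ / 5)⁻¹)), hκ5, ?_⟩
  intro x hx
  -- the half radius `s = ‖x‖/2 ≥ 1`, the scale `t = s^{κ/5} ≥ 1` and `v = t⁻¹ ≤ 1`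
  set N : ℝ := ‖x‖ with hN
  set s : ℝ := N / 2 with hs
  have hmax : max 1 (max (A ^ ((2 : ℝ) / 5)⁻¹) (B ^ (κ / 5)⁻¹)) ≤ s := by linarith
  have hs1 : 1 ≤ s := (le_max_left _ _).trans hmax
  have hspos : 0 < s := by linarith
  have hN0 : 0 ≤ N := norm_nonneg _
  have hsA : A ≤ s ^ ((2 : ℝ) / 5) :=
    (Real.rpow_inv_le_iff_of_pos hApos.le hspos.le (by norm_num)).1
      ((le_max_left _ _).trans ((le_max_right _ _).trans hmax))
  set t : ℝ := s ^ (κ / 5) with ht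
  have htB : B ≤ t :=
    (Real.rpow_inv_le_iff_of_pos hBpos.le hspos.le hκ5).1
      ((le_max_right _ _).trans ((le_max_right _ _).trans hmax))
  have ht1 : 1 ≤ t := Real.one_le_rpow hs1 hκ5.le
  have htpos : 0 < t := by linarith
  set v : ℝ := t⁻¹ with hv
  have hvpos : 0 < v := inv_pos.2 htpos
  have htv : t * v = 1 := mul_inv_cancel₀ htpos.ne'
  have hv1 : v ≤ 1 := by
    have : v ≤ t * v := le_mul_of_one_le_left hvpos.le ht1
    linarith
  -- the claimed bound reads `F(x+e)/F(x) ≤ 1 + v`; suppose not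
  have hgoal : (2 : ℝ) ^ (κ / 5) * N ^ (-(κ / 5)) = v := by
    rw [hv, ht, hs, Real.div_rpow hN0 zero_le_two, inv_div, Real.rpow_neg hN0, ← div_eq_mul_inv]
  rw [hgoal]
  by_contra hlt
  rw [not_le] at hlt
  -- the parameters of the growth step
  set K : ℕ := ⌊72 * t ^ 3 / c⌋₊ + 1 with hK
  set L : ℕ := 3 * K with hL
  set η : ℝ := C * s ^ (-κ) with hη
  set a : ℝ := 1 + v / 2 with ha
  have hK0 : (0 : ℝ) ≤ 72 * t ^ 3 / c := by positivity
  have hKgt : 72 * t ^ 3 / c < K := by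
    rw [hK]; push_cast; exact Nat.lt_floor_add_one _
  have hKle : (K : ℝ) ≤ 72 * t ^ 3 / c + 1 := by
    rw [hK]; push_cast; linarith [Nat.floor_le hK0]
  have hKpos : (0 : ℝ) < K := lt_of_le_of_lt hK0 hKgt
  have hK1 : 1 ≤ K := Nat.le_add_left 1 _
  have hL1 : 1 ≤ L := by omega
  have hLR : (L : ℝ) = 3 * K := by rw [hL, Nat.cast_mul]; norm_num
  have hL1R : (1 : ℝ) ≤ L := by exact_mod_cast hL1
  -- `L ≤ A t³`
  have ht31 : 1 ≤ t ^ 3 := one_le_pow₀ ht1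
  have hLle : (L : ℝ) ≤ A * t ^ 3 := by
    rw [hLR, hA]
    have h216 : 3 * (72 * t ^ 3 / c + 1) = 216 * t ^ 3 / c + 3 := by ring
    calc 3 * (K : ℝ) ≤ 216 * t ^ 3 / c + 3 := by linarith
      _ ≤ 216 * t ^ 3 / c + 3 * t ^ 3 := by linarith
      _ = (216 / c + 3) * t ^ 3 := by ring
  -- `L ≤ s`: `t³ = s^{3κ/5} ≤ s^{3/5}` and `A ≤ s^{2/5}`
  have ht3 : t ^ 3 = s ^ (κ / 5 * 3) := by
    rw [ht, Real.rpow_mul hspos.le, Real.rpow_ofNat]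
  have hs35 : t ^ 3 ≤ s ^ ((3 : ℝ) / 5) := by
    rw [ht3]; exact Real.rpow_le_rpow_of_exponent_le hs1 (by linarith)
  have hsplit : s ^ ((2 : ℝ) / 5) * s ^ ((3 : ℝ) / 5) = s := by
    rw [← Real.rpow_add hspos]; norm_num
  have hLs : (L : ℝ) ≤ s :=
    calc (L : ℝ) ≤ A * t ^ 3 := hLle
      _ ≤ A * s ^ ((3 : ℝ) / 5) := mul_le_mul_of_nonneg_left hs35 hApos.le
      _ ≤ s ^ ((2 : ℝ) / 5) * s ^ ((3 : ℝ) / 5) :=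
          mul_le_mul_of_nonneg_right hsA (Real.rpow_nonneg hspos.le _)
      _ = s := hsplit
  -- `η = C v⁵`, `L η ≤ v/4`, `η ≤ 1`
  have hsκ : s ^ κ = t ^ 5 := by
    rw [ht, ← Real.rpow_natCast, ← Real.rpow_mul hspos.le]
    congr 1; push_cast; ring
  have hηv : η = C * v ^ 5 := by
    rw [hη, Real.rpow_neg hspos.le, hsκ, hv, inv_pow]
  have hη0 : 0 ≤ η := by rw [hηv]; exact mul_nonneg hC (pow_nonneg hvpos.le 5)
  have htv2 : t * v ^ 2 = v := by rw [sq, ← mul_assoc, htv, one_mul]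
  have hLη : (L : ℝ) * η ≤ v / 4 := by
    rw [hηv]
    have h1 : (4 * A * C + 1) * v ^ 2 ≤ t * v ^ 2 := mul_le_mul_of_nonneg_right htB (sq_nonneg v)
    calc (L : ℝ) * (C * v ^ 5) ≤ A * t ^ 3 * (C * v ^ 5) :=
          mul_le_mul_of_nonneg_right hLle (mul_nonneg hC (pow_nonneg hvpos.le 5))
      _ = A * C * v ^ 2 * (t * v) ^ 3 := by ring
      _ = A * C * v ^ 2 := by rw [htv]; ring
      _ ≤ v / 4 := by linarith [sq_nonneg v]
  have hη1 : η ≤ 1 := by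
    have : η ≤ L * η := le_mul_of_one_le_left hη0 hL1R
    linarith
  -- the first ratio: `a ≤ (1 - Lη)·F(x+e)/F(x)`
  have ha0 : 0 ≤ a := by rw [ha]; linarith
  have hr0 : 0 < F (x + e) / F x := div_pos (hF _) (hF _)
  have haL : a ≤ (1 - (L : ℝ) * η) * (F (x + e) / F x) := by
    rw [ha]
    linarith [mul_nonneg (sub_nonneg.2 hLη) hr0.le, mul_nonneg hvpos.le (sub_nonneg.2 hv1),
      mul_nonneg (by linarith : (0 : ℝ) ≤ 1 - v / 4) (sub_nonneg.2 hlt.le)]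
  -- the points `x + m e`, `m ≤ L`, stay at norm `≥ s`, where the convexity defect is `≤ η`
  have hfar : ∀ m : ℕ, m ≤ L → s ≤ ‖x + m • e‖ := by
    intro m hm
    have h := norm_sub_le_norm_add_nsmul he x m
    have hm' : (m : ℝ) ≤ L := by exact_mod_cast hm
    linarith
  have hpts : ∀ j : ℕ, j + 2 ≤ L →
      (1 - η) * F (x + (j + 1) • e) ^ 2 ≤ F (x + (j + 1) • e + e) * F (x + (j + 1) • e - e) := by
    intro j hj
    have hsy : s ≤ ‖x + (j + 1) • e‖ := hfar (j + 1) (by omega)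
    have hy0 : x + (j + 1) • e ≠ 0 := by
      intro h0; rw [h0, norm_zero] at hsy; linarith
    have hrpow : ‖x + (j + 1) • e‖ ^ (-κ) ≤ s ^ (-κ) :=
      Real.rpow_le_rpow_of_nonpos hspos hsy (by linarith)
    have h1 : 1 - η ≤ 1 - C * ‖x + (j + 1) • e‖ ^ (-κ) := by
      have := mul_le_mul_of_nonneg_left hrpow hC
      rw [hη]; linarith
    exact (mul_le_mul_of_nonneg_right h1 (sq_nonneg _)).trans (hconv _ hy0)
  -- growth against the ceiling, and the scalar contradiction
  have hgrow := hgrowth x L a η hη0 hη1 ha0 haL hpts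
  have hceilL := hceil L hL1 x
  have hfin : a ^ L ≤ (L : ℝ) ^ 2 / c := le_of_mul_le_mul_right (hgrow.trans hceilL) (hF x)
  have hcube : ((K : ℝ) * (v / 2)) ^ 3 ≤ a ^ L := by
    rw [ha, hL]; exact cube_bernoulli (div_nonneg hvpos.le zero_le_two) K
  rw [hLR] at hfin
  exact scalar_contra hc htpos hKpos hKgt (hcube.trans hfin)

end Summit.CriticalPhenomena.Ising3DConformalLimit.EnergyNotSigmaSquaredEnergyGapPowerLaw

end
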